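import Literature.NumberTheory.Automorphic.EichlerShimuraWeightTwoSplitInjective
import Literature.NumberTheory.Automorphic.QuaternionOrderUnitsCocompact
import Literature.NumberTheory.Automorphic.FuchsianEichlerShimuraWeightTwo
import HarnessLib

/-!
# Injectivity of the weight-two real period map for FINITE-INDEX SUBGROUPS of `ι(O¹)` (every quaternion algebra `B` over `ℚ`):
# a cusp form on `Γ' ≤ ι(O¹)`, `[ι(O¹) : Γ'] < ∞`, all of whose real periods vanish is zero

Topic `NumberTheory/Automorphic`; THEOREMS ONLY (no definition, no named fact, no instance, no notation, no `sorry`). Filed by the BSD cell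
`bsd-stepL` (seat `bsd-stepL-tam3-p1` g31, LEAD of crux `CartanOnePlaceDegreeLawAtThree`, item stmt-BirchSwinnertonDyer-24801): the Literature-level
form of the injectivity step of the period-lattice discreteness theorem of that crux (tree `…Theorems.CartanCover.PrintClauses.principalLevel_eq_zero_of_forall_rePeriod_eq_zero`,
the case `Γ' = Γ̄(q)`), so that other levels between a principal congruence subgroup and `ι(O¹)` (Cartan ∕ torus ∕ Eichler-type levels of the cover) can cite it.

* `CuspForm.eq_zero_of_forall_rePeriod_eq_zero_of_isCompact` — for ANY `Γ ≤ GL₂(ℝ)` with `det = 1` and a compact `K ⊆ ℍ` meeting every `Γ`-orbit, a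
  weight-two cusp form all of whose real periods `CuspForm.rePeriod F z₀ γ` vanish is zero (maximum modulus for `exp ∘ ∫F`; Shimura Thm. 8.4, injectivity half;
  the underlying function-level statement is the tree's `coe_eq_zero_of_forall_re_period_eq_zero` of `ShimuraCurvePeriodsHeckeIntegralityProofs.lean`, whose
  import closure has no hub olean — ported privately here, as in `QuaternionOrderUnitsCocompact.lean`).
* `exists_isCompact_reps_of_finiteIndex_GL` — cocompactness passes to finite-index subgroups (Shimura Prop. 1.31; the `GL₂(ℝ)` twin of the tree's
  `exists_isCompact_reps_of_finiteIndex` for `SL(2, ℝ)`).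
* `CuspForm.eq_zero_of_forall_rePeriod_eq_zero_of_finiteIndex` — **THE THEOREM**: for a quaternion algebra `B` over `ℚ`, ANY order `O`, ANY `ℚ`-algebra map
  `ι : B → M₂(ℝ)`, ANY subgroup `Γ' ≤ normOneUnits ι hO = ι(O¹)` of finite index and ANY base point: a weight-two cusp form on `Γ'` all of whose real periods
  vanish is zero. DIVISION `B`: `Γ'` is cocompact (tree `exists_isCompact_forall_exists_mem_normOneUnits_smul_mem` + finite index) and the first bullet;
  SPLIT `B`: an arithmetic `det = 1` group `A` conjugates into `ι(O¹)` by `g` of positive determinant (tree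
  `exists_isArithmetic_conj_le_normOneUnits_of_exists_not_isUnit`); `g A g⁻¹ ⊓ Γ'` has finite index in `g A g⁻¹`, so `A ⊓ g⁻¹ Γ' g` is arithmetic
  (commensurability); restrict `F` to `g A g⁻¹ ⊓ Γ'`, translate by `g`, and apply the cusped injectivity theorem `CuspForm.eq_zero_of_forall_rePeriod_eq_zero_of_isArithmetic`.
  The dichotomy division ∕ split is plain logic. `CuspForm.eq_zero_of_forall_period_eq_zero_of_finiteIndex`: the same with complex periods.

HONEST FRAMING. Injectivity only (surjectivity in Shimura Thm. 8.4 is the named residue `eichlerShimura_weightTwo_rePeriod_surjective`); nothing about any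
summit statement; the Birch–Swinnerton-Dyer conjecture is proved for no curve.

## References

* [ShimuraIATAF1971] G. Shimura, *Introduction to the arithmetic theory of automorphic functions* (1971): §1.3 Prop. 1.31, Thm. 8.4 p. 234, §9.2 p. 246.
* [VignerasLNM800] M.-F. Vignéras, *Arithmétique des algèbres de quaternions*, LNM 800 (1980): Ch. IV §1 Thm. 1.1 p. 104, Prop. 1.4 p. 105.
* [Bergeron2016] N. Bergeron, *The Spectrum of Hyperbolic Surfaces* (2016): §2.2 Lemma 2.7 p. 41, §2.3.1 p. 44.
-/

set_option autoImplicit false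

noncomputable section

open scoped MatrixGroups ModularForm Pointwise
open UpperHalfPlane hiding I
open ConjAct

namespace Literature.NumberTheory.Automorphic

/-! ### §1 A weight-two form with purely imaginary periods on a cocompact group vanishes -/

section Cocompact

variable {Γ : Subgroup (GL (Fin 2) ℝ)} [Γ.HasDetOne]

/-- `Ψ(γτ) = Ψ(τ) + ∫_{τ₀}^{γτ₀} F` for the primitive `Ψ = ∫_{τ₀}^τ F` and `γ ∈ Γ`.
-- adapted from Literature/NumberTheory/Automorphic/ShimuraCurvePeriodsHeckeIntegralityProofs.lean §2 (no hub olean for that module's closure)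
[cite: ShimuraIATAF1971, §8.2 (8.2.19)–(8.2.20)] -/
private theorem CuspForm.segmentIntegral_smul_eq_add_segmentIntegral' (F : CuspForm Γ 2) {γ : GL (Fin 2) ℝ} (hγ : γ ∈ Γ) (τ₀ τ : ℍ) :
    segmentIntegral F τ₀ (γ • τ) = segmentIntegral F τ₀ τ + segmentIntegral F τ₀ (γ • τ₀) := by
  have hdet : 0 < γ.det.val := by
    rw [Subgroup.HasDetOne.det_eq hγ, Units.val_one]; exact one_pos
  have hinv : segmentIntegral F (γ • τ₀) (γ • τ) = segmentIntegral F τ₀ τ := by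
    rw [← segmentIntegral_slash_eq F hdet τ₀ τ, SlashInvariantForm.slash_action_eqn F γ hγ]
  have e2 := segmentIntegral_sub_segmentIntegral F τ₀ (γ • τ₀) (γ • τ)
  linear_combination e2 + hinv

/-- **A weight-two form with purely imaginary periods on a cocompact group vanishes** (Shimura Thm. 8.4, injectivity half): if a compact `K ⊆ ℍ` meets
every `Γ`-orbit and `Re ∫_{τ₀}^{γτ₀} F = 0` for all `γ ∈ Γ`, then `u = Re ∫_{τ₀}^τ F` is `Γ`-invariant and continuous, so attains its maximum; `|exp ∫F| = exp u`
has an interior maximum, `exp ∫F` is constant (maximum modulus on the connected open `ℍ ⊆ ℂ`), and `F = (∫F)' = 0`.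
-- adapted from Literature/NumberTheory/Automorphic/ShimuraCurvePeriodsHeckeIntegralityProofs.lean §3 (no hub olean for that module's closure)
[cite: ShimuraIATAF1971, Thm. 8.4 p. 234] -/
private theorem CuspForm.coe_eq_zero_of_forall_re_period_eq_zero_of_isCompact' {K : Set ℍ} (hK : IsCompact K)
    (hcov : ∀ τ : ℍ, ∃ γ ∈ Γ, γ • τ ∈ K) (F : CuspForm Γ 2) (τ₀ : ℍ)
    (H : ∀ γ ∈ Γ, (segmentIntegral F τ₀ (γ • τ₀)).re = 0) : (⇑F : ℍ → ℂ) = 0 := by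
  set Ψ : ℍ → ℂ := segmentIntegral F τ₀ with hΨdef
  have hinv : ∀ γ ∈ Γ, ∀ τ : ℍ, (Ψ (γ • τ)).re = (Ψ τ).re := by
    intro γ hγ τ
    rw [hΨdef, CuspForm.segmentIntegral_smul_eq_add_segmentIntegral' F hγ τ₀ τ, Complex.add_re, H γ hγ, add_zero]
  have hderiv : ∀ z : ℂ, 0 < z.im → HasDerivAt (Ψ ∘ ofComplex) (F (ofComplex z)) z :=
    fun z hz => hasDerivAt_segmentIntegral F τ₀ hz
  have hdiff : DifferentiableOn ℂ (Ψ ∘ ofComplex) {z : ℂ | 0 < z.im} :=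
    differentiableOn_segmentIntegral F τ₀
  have hΨc : Continuous Ψ := by
    have h2 : Ψ = (Ψ ∘ ofComplex) ∘ ((↑) : ℍ → ℂ) := by
      funext τ; simp [ofComplex_apply]
    rw [h2]
    exact hdiff.continuousOn.comp_continuous continuous_coe fun τ => τ.im_pos
  have hKne : K.Nonempty := by
    obtain ⟨γ, -, hγ⟩ := hcov UpperHalfPlane.I
    exact ⟨_, hγ⟩
  obtain ⟨k, hkK, hk⟩ := hK.exists_isMaxOn hKne (Complex.continuous_re.comp hΨc).continuousOn
  have hmax : ∀ τ : ℍ, (Ψ τ).re ≤ (Ψ k).re := by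
    intro τ
    obtain ⟨γ, hγ, hγτ⟩ := hcov τ
    rw [← hinv γ hγ τ]
    exact hk hγτ
  set f : ℂ → ℂ := fun z => Complex.exp ((Ψ ∘ ofComplex) z) with hfdef
  have hfd : DifferentiableOn ℂ f {z : ℂ | 0 < z.im} := hdiff.cexp
  have hkU : (k : ℂ) ∈ {z : ℂ | 0 < z.im} := k.im_pos
  have hfmax : IsMaxOn (norm ∘ f) {z : ℂ | 0 < z.im} (k : ℂ) := by
    intro z hz
    simp only [Function.comp_apply, hfdef, Complex.norm_exp, Set.mem_setOf_eq]
    refine Real.exp_le_exp.mpr ?_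
    rw [ofComplex_apply, ofComplex_apply_of_im_pos hz]
    exact hmax _
  have hconst := Complex.eqOn_of_isPreconnected_of_isMaxOn_norm
    (convex_halfSpace_im_gt 0).isPreconnected isOpen_upperHalfPlaneSet hfd hkU hfmax
  funext τ
  have hτ : 0 < (τ : ℂ).im := τ.im_pos
  have hd1 : HasDerivAt f (Complex.exp ((Ψ ∘ ofComplex) (τ : ℂ)) * F (ofComplex (τ : ℂ))) (τ : ℂ) :=
    (hderiv (τ : ℂ) hτ).cexp
  have hd2 : HasDerivAt f 0 (τ : ℂ) := by
    have hev : f =ᶠ[nhds (τ : ℂ)] fun _ => f (k : ℂ) :=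
      Filter.eventuallyEq_of_mem (isOpen_upperHalfPlaneSet.mem_nhds hτ) hconst
    exact (hasDerivAt_const (τ : ℂ) (f (k : ℂ))).congr_of_eventuallyEq hev
  have h0 := hd1.unique hd2
  rw [ofComplex_apply] at h0
  rcases mul_eq_zero.mp h0 with h1 | h1
  · exact absurd h1 (Complex.exp_ne_zero _)
  · simpa using h1

/-- The same, packaged with `CuspForm.rePeriod`: on a cocompact `det = 1` group, a weight-two cusp form with all real periods zero is zero.
[cite: ShimuraIATAF1971, Thm. 8.4 p. 234] -/
theorem CuspForm.eq_zero_of_forall_rePeriod_eq_zero_of_isCompact {K : Set ℍ} (hK : IsCompact K)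
    (hcov : ∀ τ : ℍ, ∃ γ ∈ Γ, γ • τ ∈ K) (z₀ : ℍ) (F : CuspForm Γ 2)
    (hF : ∀ γ : Γ, CuspForm.rePeriod F z₀ γ = 0) : F = 0 := by
  have h0 := CuspForm.coe_eq_zero_of_forall_re_period_eq_zero_of_isCompact' hK hcov F z₀ fun γ hγ => by
    have h := hF ⟨γ, hγ⟩
    rwa [CuspForm.rePeriod_apply] at h
  exact DFunLike.coe_injective (h0.trans CuspForm.coe_zero.symm)

omit [Γ.HasDetOne] in
/-- **Cocompactness passes to finite-index subgroups** (`GL₂(ℝ)` form): if a compact `K` meets every `Γ`-orbit and `Γ' ≤ Γ` has finite index, a compact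
`K'` (finitely many translates of `K` by coset representatives) meets every `Γ' ⊓ Γ`-orbit, stated for the elements of `Γ'`. [cite: ShimuraIATAF1971, §1.3 Prop. 1.31] -/
theorem exists_isCompact_reps_of_finiteIndex_GL {Γ' : Subgroup (GL (Fin 2) ℝ)} (hfi : (Γ'.subgroupOf Γ).FiniteIndex)
    {K : Set ℍ} (hK : IsCompact K) (hcov : ∀ z : ℍ, ∃ γ ∈ Γ, γ • z ∈ K) :
    ∃ K' : Set ℍ, IsCompact K' ∧ ∀ z : ℍ, ∃ γ ∈ Γ', γ • z ∈ K' := by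
  classical
  haveI := hfi
  haveI : Finite (Γ ⧸ Γ'.subgroupOf Γ) := Subgroup.finite_quotient_of_finiteIndex
  refine ⟨⋃ c : Γ ⧸ Γ'.subgroupOf Γ, (fun z : ℍ => ((c.out : Γ) : GL (Fin 2) ℝ)⁻¹ • z) '' K,
    isCompact_iUnion fun c => hK.image (continuous_const_smul _), fun z => ?_⟩
  obtain ⟨γ, hγ, hγz⟩ := hcov z
  set c : Γ ⧸ Γ'.subgroupOf Γ := QuotientGroup.mk ⟨γ, hγ⟩ with hc
  have hmem : ((c.out : Γ) : GL (Fin 2) ℝ)⁻¹ * γ ∈ Γ' := by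
    have h : (c.out : Γ)⁻¹ * ⟨γ, hγ⟩ ∈ Γ'.subgroupOf Γ := by
      rw [← QuotientGroup.eq, QuotientGroup.out_eq', hc]
    simpa [Subgroup.mem_subgroupOf] using h
  refine ⟨((c.out : Γ) : GL (Fin 2) ℝ)⁻¹ * γ, hmem, Set.mem_iUnion.mpr ⟨c, ⟨γ • z, hγz, ?_⟩⟩⟩
  rw [mul_smul]

omit [Γ.HasDetOne] in
/-- `det = 1` is preserved under conjugation of the level. [folklore] -/
private theorem hasDetOne_conjAct_smul (hΓ : Γ.HasDetOne) (x : GL (Fin 2) ℝ) : (toConjAct x • Γ).HasDetOne := by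
  refine ⟨fun {g} hg => ?_⟩
  obtain ⟨y, hy, rfl⟩ := (Subgroup.mem_smul_pointwise_iff_exists g _ _).mp hg
  haveI := hΓ
  rw [toConjAct_smul, map_mul, map_mul, map_inv, Subgroup.HasDetOne.det_eq hy, mul_one, mul_inv_cancel]

end Cocompact

/-! ### §2 Finite-index subgroups of `ι(O¹)`: injectivity of the real period map, every `B` -/

section FiniteIndex

variable (B : Type*) [Ring B] [Algebra ℚ B] [IsQuaternionAlgebra ℚ B] (O : Submodule ℤ B) (hO : Brandt.IsOrder B O)
  (ι : B →ₐ[ℚ] Matrix (Fin 2) (Fin 2) ℝ)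

/-- **INJECTIVITY IN SHIMURA Thm. 8.4 (`n = 0`) FOR FINITE-INDEX SUBGROUPS OF `ι(O¹)`, `B` A DIVISION ALGEBRA**: `Γ'` is cocompact (the unit group is, and the
index is finite), so maximum modulus applies. [cite: ShimuraIATAF1971, Thm. 8.4 p. 234, §1.3 Prop. 1.31 and §9.2 p. 246] [cite: VignerasLNM800, Ch. IV §1 Thm. 1.1 p. 104] -/
theorem CuspForm.eq_zero_of_forall_rePeriod_eq_zero_of_finiteIndex_of_forall_isUnit (hdiv : ∀ x : B, x ≠ 0 → IsUnit x)
    (Γ' : Subgroup (GL (Fin 2) ℝ)) (hle : Γ' ≤ normOneUnits ι hO) (hfi : (Γ'.subgroupOf (normOneUnits ι hO)).FiniteIndex)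
    (z₀ : ℍ) (F : CuspForm Γ' 2) (hF : ∀ γ : Γ', CuspForm.rePeriod F z₀ γ = 0) : F = 0 := by
  haveI : Γ'.HasDetOne := ⟨fun {g} hg => Subgroup.HasDetOne.det_eq (hle hg)⟩
  obtain ⟨K, hK, hcov⟩ := exists_isCompact_forall_exists_mem_normOneUnits_smul_mem B O hO ι hdiv
  obtain ⟨K', hK', hcov'⟩ := exists_isCompact_reps_of_finiteIndex_GL hfi hK hcov
  exact CuspForm.eq_zero_of_forall_rePeriod_eq_zero_of_isCompact hK' hcov' z₀ F hF

/-- **INJECTIVITY IN SHIMURA Thm. 8.4 (`n = 0`) FOR FINITE-INDEX SUBGROUPS OF `ι(O¹)`, `B` WITH A NON-ZERO NON-UNIT** (`B ≅ M₂(ℚ)`, the cusped case): cut the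
arithmetic conjugate `g A g⁻¹ ≤ ι(O¹)` down to `g A g⁻¹ ⊓ Γ'` (finite index in `g A g⁻¹`, so `A ⊓ g⁻¹Γ'g` is arithmetic), restrict, translate by `g`, and apply the
cusped injectivity theorem. [cite: ShimuraIATAF1971, Thm. 8.4 p. 234 and §9.2 p. 246] [cite: Bergeron2016, §2.2 Lemma 2.7 p. 41 and §2.3.1 p. 44] [cite: VignerasLNM800, Ch. IV §1 Prop. 1.4 p. 105] -/
theorem CuspForm.eq_zero_of_forall_rePeriod_eq_zero_of_finiteIndex_of_exists_not_isUnit (hsplit : ∃ x : B, x ≠ 0 ∧ ¬ IsUnit x)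
    (Γ' : Subgroup (GL (Fin 2) ℝ)) (hle : Γ' ≤ normOneUnits ι hO) (hfi : (Γ'.subgroupOf (normOneUnits ι hO)).FiniteIndex)
    (z₀ : ℍ) (F : CuspForm Γ' 2) (hF : ∀ γ : Γ', CuspForm.rePeriod F z₀ γ = 0) : F = 0 := by
  obtain ⟨A, g, hA, hA1, hdet, hAle⟩ := exists_isArithmetic_conj_le_normOneUnits_of_exists_not_isUnit B O hO ι hsplit
  set Δ : Subgroup (GL (Fin 2) ℝ) := toConjAct g • A ⊓ Γ' with hΔdef
  have hΔle : Δ ≤ Γ' := inf_le_right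
  -- `Δ` has finite index in `g A g⁻¹`
  have h0 : Γ'.relIndex (normOneUnits ι hO) ≠ 0 := hfi.index_ne_zero
  have h1 : Γ'.relIndex (toConjAct g • A) ≠ 0 := fun h => h0 (Subgroup.relIndex_eq_zero_of_le_right hAle h)
  have h2 : Δ.relIndex (toConjAct g • A) ≠ 0 := by
    rw [hΔdef, Subgroup.inf_relIndex_left]
    exact h1
  have hgA : toConjAct g⁻¹ • (toConjAct g • A) = A := by
    rw [← mul_smul, ← map_mul, inv_mul_cancel, map_one, one_smul]
  -- so `g⁻¹ Δ g ≤ A` is arithmetic, with `det = 1`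
  haveI hArith : (toConjAct g⁻¹ • Δ).IsArithmetic := by
    haveI := hA
    refine ⟨Subgroup.Commensurable.trans ⟨?_, ?_⟩ (Subgroup.IsArithmetic.is_commensurable (𝒢 := A))⟩
    · rw [← hgA, Subgroup.relIndex_pointwise_smul]
      exact h2
    · have hle' : toConjAct g⁻¹ • Δ ≤ A := by
        rw [← hgA]
        exact Subgroup.pointwise_smul_le_pointwise_smul_iff.mpr inf_le_left
      rw [Subgroup.relIndex_eq_one.mpr hle']
      exact one_ne_zero
  have hΔ1 : Δ.HasDetOne := ⟨fun {x} hx => Subgroup.HasDetOne.det_eq (hle (hΔle hx))⟩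
  haveI : (toConjAct g⁻¹ • Δ).HasDetOne := hasDetOne_conjAct_smul hΔ1 g⁻¹
  -- restriction of `F` to `Δ ≤ Γ'`
  let Fr : CuspForm Δ 2 :=
    { toFun := F
      slash_action_eq' := fun γ hγ => SlashInvariantForm.slash_action_eqn F γ (hΔle hγ)
      holo' := F.holo'
      zero_at_cusps' := fun hc => F.zero_at_cusps' (hc.mono hΔle) }
  -- translate to the arithmetic level `g⁻¹ Δ g`
  set G : CuspForm (toConjAct g⁻¹ • Δ) 2 := CuspForm.translate Fr g with hGdef
  have hcoeG : (⇑G : ℍ → ℂ) = (⇑F : ℍ → ℂ) ∣[(2 : ℤ)] g := rfl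
  have hG : ∀ δ : ↥(toConjAct g⁻¹ • Δ), CuspForm.rePeriod G (g⁻¹ • z₀) δ = 0 := by
    intro δ
    obtain ⟨y, hy, hyδ⟩ := (Subgroup.mem_smul_pointwise_iff_exists (δ : GL (Fin 2) ℝ) _ _).mp δ.2
    rw [CuspForm.rePeriod_apply, hcoeG, segmentIntegral_slash_eq F hdet]
    have e1 : g • g⁻¹ • z₀ = z₀ := smul_inv_smul g z₀
    have e2 : g • (δ : GL (Fin 2) ℝ) • g⁻¹ • z₀ = y • z₀ := by
      rw [← hyδ, toConjAct_smul, smul_smul, smul_smul]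
      congr 1
      group
    rw [e1, e2]
    have hp := hF ⟨y, hΔle hy⟩
    rwa [CuspForm.rePeriod_apply] at hp
  have hG0 : G = 0 := CuspForm.eq_zero_of_forall_rePeriod_eq_zero_of_isArithmetic (g⁻¹ • z₀) G hG
  have hF0 : (⇑F : ℍ → ℂ) = 0 := by
    have h3 : (⇑F : ℍ → ℂ) = ((⇑F : ℍ → ℂ) ∣[(2 : ℤ)] g) ∣[(2 : ℤ)] g⁻¹ := by
      rw [← SlashAction.slash_mul, mul_inv_cancel, SlashAction.slash_one]
    rw [h3, ← hcoeG, hG0, CuspForm.coe_zero, SlashAction.zero_slash]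
  exact DFunLike.coe_injective (hF0.trans CuspForm.coe_zero.symm)

/-- **INJECTIVITY OF THE WEIGHT-TWO REAL PERIOD MAP FOR EVERY FINITE-INDEX SUBGROUP OF `ι(O¹)`** (every quaternion algebra `B` over `ℚ`, every order `O`,
every `ℚ`-algebra map `ι : B → M₂(ℝ)`, every base point): a weight-two cusp form on `Γ' ≤ ι(O¹)`, `[ι(O¹) : Γ'] < ∞`, all of whose real periods
`Re ∫_{z₀}^{γ z₀} F` vanish is zero. [cite: ShimuraIATAF1971, Thm. 8.4 p. 234 and §9.2 p. 246] -/
theorem CuspForm.eq_zero_of_forall_rePeriod_eq_zero_of_finiteIndex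
    (Γ' : Subgroup (GL (Fin 2) ℝ)) (hle : Γ' ≤ normOneUnits ι hO) (hfi : (Γ'.subgroupOf (normOneUnits ι hO)).FiniteIndex)
    (z₀ : ℍ) (F : CuspForm Γ' 2) (hF : ∀ γ : Γ', CuspForm.rePeriod F z₀ γ = 0) : F = 0 := by
  by_cases hdiv : ∀ x : B, x ≠ 0 → IsUnit x
  · exact CuspForm.eq_zero_of_forall_rePeriod_eq_zero_of_finiteIndex_of_forall_isUnit B O hO ι hdiv Γ' hle hfi z₀ F hF
  · push Not at hdiv
    exact CuspForm.eq_zero_of_forall_rePeriod_eq_zero_of_finiteIndex_of_exists_not_isUnit B O hO ι hdiv Γ' hle hfi z₀ F hF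

/-- The same with COMPLEX periods: a weight-two cusp form on a finite-index `Γ' ≤ ι(O¹)` all of whose periods `∫_{z₀}^{γ z₀} F` vanish is zero.
[cite: ShimuraIATAF1971, Thm. 8.4 p. 234] -/
theorem CuspForm.eq_zero_of_forall_period_eq_zero_of_finiteIndex
    (Γ' : Subgroup (GL (Fin 2) ℝ)) (hle : Γ' ≤ normOneUnits ι hO) (hfi : (Γ'.subgroupOf (normOneUnits ι hO)).FiniteIndex)
    (z₀ : ℍ) (F : CuspForm Γ' 2) (hF : ∀ γ : Γ', CuspForm.period F z₀ γ = 0) : F = 0 :=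
  CuspForm.eq_zero_of_forall_rePeriod_eq_zero_of_finiteIndex B O hO ι Γ' hle hfi z₀ F fun γ => by
    change (CuspForm.period F z₀ γ).re = 0
    rw [hF γ, Complex.zero_re]

/-- In particular for `Γ' = ι(O¹)` itself (both injectivity halves of (ESᶜ) in one statement, every `B`). [cite: ShimuraIATAF1971, Thm. 8.4 p. 234 and §9.2 p. 246] -/
theorem CuspForm.eq_zero_of_forall_rePeriod_eq_zero_normOneUnits (z₀ : ℍ) (F : CuspForm (normOneUnits ι hO) 2)
    (hF : ∀ γ : normOneUnits ι hO, CuspForm.rePeriod F z₀ γ = 0) : F = 0 :=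
  CuspForm.eq_zero_of_forall_rePeriod_eq_zero_of_finiteIndex B O hO ι (normOneUnits ι hO) le_rfl
    (by rw [Subgroup.subgroupOf_self]; infer_instance) z₀ F hF

end FiniteIndex

end Literature.NumberTheory.Automorphic

end
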